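import Summits.QuantumFields.YangMills.Theorems.FiniteRankMirrorPeeling
import Summits.QuantumFields.YangMills.Theorems.BalabanLadderUVSeamRecResponseVarianceTwoPoint
import Summits.QuantumFields.YangMills.Theorems.UniversalDetectorReflectedKernel
import HarnessLib

/-!
# Route `FiniteRankMirror`, LINE g9-1 «two-cube Markov peeling» — pair and mirror two-point bounds from response moments

Ideator seat ym-idea-8 (generation 9, lens «dual»).  The two estimates behind the glue item
`Summit.QuantumFields.YangMills.Theses.FiniteRankMirror.CrossPeelingGlue` (stmt-QuantumFields-23839): the pointwise `dist⁻⁸` mirror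
two-point CEILING of the plaquette action density from singleton femto RESPONSE MOMENTS, by peeling BOTH slots of the
covariance onto cube kernels.

* §3 `abs_torusCov_plane_le_of_expMoments` — two plaquettes whose radius-`R+1` cubes have disjoint closed collars, each
  obeying the exponential response moment `E_T exp((R⁴/C₁)|kerE_Q(plane) − p|) ≤ e^B`: `|Cov_T| ≤ 4e^B C₁²/R⁸`
  (`twoCube_peel` + `MarkovMirror.torusE_sq_le_of_expMoment`).
* §4 `abs_mirrorCov_dens_le_of_expMoments` — the mirror pair `Cov_T(dens_x∘Θ₀, dens_y)` expanded into its 36 plane pairs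
  (`UniversalDetectorPlaneTight.cov_dens_mul_dens_cfgReflect_eq_sum`; the reflected plaquette sits at time `−x₀` or
  `−x₀−1`), each pair bounded by §3: `≤ 256·4e^B C₁²/R⁸` when `2R+6 ≤` the mirror sup-distance.
* the assembly of the glue item `CrossPeelingGlue` is the next file (`FiniteRankMirrorCrossPeelingGlue`).

HONEST FRAMING: bookkeeping over the OPEN engine item `FemtoResponseMoments` (spine-owed); nothing of E0′, (RM), NT or
the mass gap is proved here; no summit is proved by this line; not Clay.
-/

set_option autoImplicit false

noncomputable section

open MeasureTheory Filter Topology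
open Literature.MathematicalPhysics.QuantumFieldTheory Literature.MathematicalPhysics.QuantumLattice
open Literature.Probability.LatticeModels
open Summit.QuantumFields.YangMills.Cruxes.OSLegsFromFemtoAndGap.DlrCollarTransfer
open Summit.QuantumFields.YangMills.Cruxes.UVSeamRec.ResponseVariance (supp_plane_window)
open Summit.QuantumFields.YangMills.Cruxes.NT.MarkovMirror (torusE_sq_le_of_expMoment)
open Summit.QuantumFields.YangMills.Cruxes.UVSeamRec.TemperedResponse (continuous_kerE_plane)
open Summit.QuantumFields.YangMills.Cruxes.UniversalDetectorPlaneTight (cov_dens_mul_dens_cfgReflect_eq_sum)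
open Summit.QuantumFields.YangMills.Cruxes.FiniteRankMirrorPeeling (twoCube_peel)

namespace Summit.QuantumFields.YangMills.Cruxes.FiniteRankMirrorPeeling

variable (G : Type) [Group G] [TopologicalSpace G] [IsTopologicalGroup G] [CompactSpace G]
  [MeasurableSpace G] [BorelSpace G] (r : LatticeRep G)

/-! ## §3 The pair bound in the letters of (RM): `|Cov_T(P₁, P₂)| ≤ 4e^B C₁²/R⁸` for plaquettes `2R+6` apart -/

omit [MeasurableSpace G] [BorelSpace G] in
/-- The cube of side `2R+3` based at `z − (R+1)` sits in the coordinate window of the odd torus `2L+1` with the margins of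
`twoCube_peel` as soon as `|z j| + R + 6 ≤ L`. [folklore] -/
theorem cube_window_of_abs_le {L R : ℕ} {z : Fin 4 → ℤ} (hz : ∀ j, |z j| + (R : ℤ) + 6 ≤ (L : ℤ)) :
    ∀ j, -(L : ℤ) + 2 ≤ (fun k => z k - ((R : ℤ) + 1)) j ∧
      (fun k => z k - ((R : ℤ) + 1)) j + ((2 * R + 3 : ℕ) : ℤ) + 3 ≤ (L : ℤ) := by
  intro j
  have h := hz j
  have h1 := le_abs_self (z j)
  have h2 := neg_abs_le (z j)
  dsimp only
  push_cast
  constructor <;> linarith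

/-- **Pair bound.**  Two plaquettes `(q₁, z₁)`, `(q₂, z₂)` with `|zᵢ j| + R + 6 ≤ L` and `2R+6 ≤ |z₁ j₀ − z₂ j₀|` in some
direction, each obeying the singleton exponential response moment of (RM) at radius `R ≥ 1`:
`|Cov_T(P_{q₁}(z₁), P_{q₂}(z₂))| ≤ 4e^B C₁²/R⁸` — two-cube peeling + `x²/2 ≤ eˣ`. [folklore] -/
theorem abs_torusCov_plane_le_of_expMoments {β : ℝ} {L R : ℕ} (hR : 1 ≤ R) (q₁ q₂ : Fin 4 × Fin 4)
    (z₁ z₂ : Fin 4 → ℤ) (hz₁ : ∀ j, |z₁ j| + (R : ℤ) + 6 ≤ (L : ℤ)) (hz₂ : ∀ j, |z₂ j| + (R : ℤ) + 6 ≤ (L : ℤ))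
    (hsep : ∃ j, z₁ j + 2 * (R : ℤ) + 6 ≤ z₂ j ∨ z₂ j + 2 * (R : ℤ) + 6 ≤ z₁ j)
    {C₁ B p₁ p₂ : ℝ} (hC₁ : 0 < C₁)
    (h₁ : torusE G r β L (fun U => Real.exp ((R : ℝ) ^ 4 / C₁ *
        |kerE G r β (fun k => z₁ k - ((R : ℤ) + 1)) (2 * R + 3) U (plane G r q₁ z₁) - p₁|)) ≤ Real.exp B)
    (h₂ : torusE G r β L (fun U => Real.exp ((R : ℝ) ^ 4 / C₁ *
        |kerE G r β (fun k => z₂ k - ((R : ℤ) + 1)) (2 * R + 3) U (plane G r q₂ z₂) - p₂|)) ≤ Real.exp B) :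
    |torusE G r β L (fun U => plane G r q₁ z₁ U * plane G r q₂ z₂ U) -
        torusE G r β L (plane G r q₁ z₁) * torusE G r β L (plane G r q₂ z₂)| ≤
      4 * Real.exp B * C₁ ^ 2 / (R : ℝ) ^ 8 := by
  obtain ⟨CP, hCP⟩ := exists_abs_plane_le (G := G) r
  have hsep' : ∃ j, (fun k => z₁ k - ((R : ℤ) + 1)) j + ((2 * R + 3 : ℕ) : ℤ) + 3 ≤ (fun k => z₂ k - ((R : ℤ) + 1)) j ∨
      (fun k => z₂ k - ((R : ℤ) + 1)) j + ((2 * R + 3 : ℕ) : ℤ) + 3 ≤ (fun k => z₁ k - ((R : ℤ) + 1)) j := by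
    obtain ⟨j, hj⟩ := hsep
    refine ⟨j, ?_⟩
    dsimp only
    push_cast
    rcases hj with h | h
    · left; linarith
    · right; linarith
  have hpeel := twoCube_peel G r β L (fun k => z₁ k - ((R : ℤ) + 1)) (fun k => z₂ k - ((R : ℤ) + 1))
    (2 * R + 3) (2 * R + 3) (cube_window_of_abs_le hz₁) (cube_window_of_abs_le hz₂) hsep'
    (continuous_plane r q₁ z₁) (continuous_plane r q₂ z₂) (hCP q₁ z₁) (hCP q₂ z₂)
    (isCylinder_plane r q₁ z₁) (isCylinder_plane r q₂ z₂) (supp_plane_window R q₁ z₁) (supp_plane_window R q₂ z₂)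
    p₁ p₂
  -- mean-square responses from the exponential moments
  have hlam : 0 < (R : ℝ) ^ 4 / C₁ := by positivity
  have hRpos : (0 : ℝ) < (R : ℝ) := by exact_mod_cast hR
  have e2 : 2 * Real.exp B / ((R : ℝ) ^ 4 / C₁) ^ 2 = 2 * Real.exp B * C₁ ^ 2 / (R : ℝ) ^ 8 := by
    field_simp
  have hk₁ : Continuous fun U => kerE G r β (fun k => z₁ k - ((R : ℤ) + 1)) (2 * R + 3) U (plane G r q₁ z₁) - p₁ :=
    (continuous_kerE_plane r β _ (2 * R + 3) q₁ z₁).sub continuous_const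
  have hk₂ : Continuous fun U => kerE G r β (fun k => z₂ k - ((R : ℤ) + 1)) (2 * R + 3) U (plane G r q₂ z₂) - p₂ :=
    (continuous_kerE_plane r β _ (2 * R + 3) q₂ z₂).sub continuous_const
  have hms₁ : torusE G r β L (fun U => (kerE G r β (fun k => z₁ k - ((R : ℤ) + 1)) (2 * R + 3) U (plane G r q₁ z₁) - p₁) ^ 2)
      ≤ 2 * Real.exp B * C₁ ^ 2 / (R : ℝ) ^ 8 := by
    rw [← e2]; exact torusE_sq_le_of_expMoment G r β L hk₁ hlam h₁
  have hms₂ : torusE G r β L (fun U => (kerE G r β (fun k => z₂ k - ((R : ℤ) + 1)) (2 * R + 3) U (plane G r q₂ z₂) - p₂) ^ 2)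
      ≤ 2 * Real.exp B * C₁ ^ 2 / (R : ℝ) ^ 8 := by
    rw [← e2]; exact torusE_sq_le_of_expMoment G r β L hk₂ hlam h₂
  set M := 2 * Real.exp B * C₁ ^ 2 / (R : ℝ) ^ 8 with hM
  have hM0 : 0 ≤ M := by positivity
  have hs₁ := Real.sqrt_le_sqrt hms₁
  have hs₂ := Real.sqrt_le_sqrt hms₂
  have hprod : Real.sqrt (torusE G r β L (fun U =>
        (kerE G r β (fun k => z₁ k - ((R : ℤ) + 1)) (2 * R + 3) U (plane G r q₁ z₁) - p₁) ^ 2)) *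
      Real.sqrt (torusE G r β L (fun U =>
        (kerE G r β (fun k => z₂ k - ((R : ℤ) + 1)) (2 * R + 3) U (plane G r q₂ z₂) - p₂) ^ 2)) ≤ M := by
    calc _ ≤ Real.sqrt M * Real.sqrt M :=
          mul_le_mul hs₁ hs₂ (Real.sqrt_nonneg _) (Real.sqrt_nonneg _)
      _ = M := Real.mul_self_sqrt hM0
  calc _ ≤ _ := hpeel
    _ ≤ 2 * M := by rw [mul_assoc]; exact mul_le_mul_of_nonneg_left hprod (by norm_num)
    _ = 4 * Real.exp B * C₁ ^ 2 / (R : ℝ) ^ 8 := by rw [hM]; ring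


/-! ## §4 The mirror two-point bound at fixed `(β, L, x, y, R)`: 36 plane pairs -/

omit [Group G] [TopologicalSpace G] [IsTopologicalGroup G] [CompactSpace G] [MeasurableSpace G] [BorelSpace G] r in
/-- Coordinates of the reflected plaquette site `σ_q(ϑx)`: time `−x 0` or `−x 0 − 1`, space unchanged. [folklore] -/
theorem reflSite_coords (x : Fin 4 → ℤ) (el : Prop) [Decidable el] :
    ((if el then siteReflect x - Pi.single 0 1 else siteReflect x) 0 = -x 0 ∨
      (if el then siteReflect x - Pi.single 0 1 else siteReflect x) 0 = -x 0 - 1) ∧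
    ∀ j : Fin 4, j ≠ 0 → (if el then siteReflect x - Pi.single 0 1 else siteReflect x) j = x j := by
  constructor
  · by_cases h : el
    · right; simp [h, siteReflect_apply_zero]
    · left; simp [h, siteReflect_apply_zero]
  · intro j hj
    by_cases h : el
    · simp [h, siteReflect_apply_of_ne _ hj, Pi.single_eq_of_ne hj]
    · simp [h, siteReflect_apply_of_ne _ hj]

/-- **Mirror two-point bound at fixed data.**  `1 ≤ R`; sites `x`, `y` with `|x j| + R + 7 ≤ L`, `|y j| + R + 7 ≤ L`; mirror
separation `2R+6 ≤ x 0 + y 0` or `2R+6 ≤ |x j − y j|` for some spatial `j`; every plaquette obeys the singleton exponential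
response moment at radius `R` on this torus.  Then `|Cov_T(dens x ∘ Θ₀, dens y)| ≤ 256·4e^B C₁²/R⁸`. [folklore] -/
theorem abs_mirrorCov_dens_le_of_expMoments {β : ℝ} {L R : ℕ} (hR : 1 ≤ R) (x y : Fin 4 → ℤ)
    (hx : ∀ j, |x j| + (R : ℤ) + 7 ≤ (L : ℤ)) (hy : ∀ j, |y j| + (R : ℤ) + 7 ≤ (L : ℤ))
    (hsep : 2 * (R : ℤ) + 6 ≤ x 0 + y 0 ∨ ∃ j, j ≠ 0 ∧ (x j + 2 * (R : ℤ) + 6 ≤ y j ∨ y j + 2 * (R : ℤ) + 6 ≤ x j))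
    {C₁ B : ℝ} (hC₁ : 0 < C₁) (p' : Fin 4 × Fin 4 → ℝ)
    (hlaw : ∀ (q : Fin 4 × Fin 4) (z : Fin 4 → ℤ), q.1 < q.2 →
      torusE G r β L (fun U => Real.exp ((R : ℝ) ^ 4 / C₁ *
        |kerE G r β (fun k => z k - ((R : ℤ) + 1)) (2 * R + 3) U (plane G r q z) - p' q|)) ≤ Real.exp B) :
    |torusE G r β L (fun V => dens G r x (cfgReflect V) * dens G r y V) -
        torusE G r β L (dens G r x) * torusE G r β L (dens G r y)| ≤
      256 * (4 * Real.exp B * C₁ ^ 2 / (R : ℝ) ^ 8) := by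
  set M := 4 * Real.exp B * C₁ ^ 2 / (R : ℝ) ^ 8 with hM
  have hM0 : 0 ≤ M := by positivity
  -- symmetrise and expand into plane pairs
  have hsym : torusE G r β L (fun V => dens G r x (cfgReflect V) * dens G r y V) -
      torusE G r β L (dens G r x) * torusE G r β L (dens G r y) =
      torusE G r β L (fun V => dens G r y V * dens G r x (cfgReflect V)) -
        torusE G r β L (dens G r y) * torusE G r β L (dens G r x) := by
    have e : (fun V => dens G r x (cfgReflect V) * dens G r y V) = fun V => dens G r y V * dens G r x (cfgReflect V) :=
      funext fun V => mul_comm _ _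
    rw [e, mul_comm (torusE G r β L (dens G r x))]
  rw [hsym, cov_dens_mul_dens_cfgReflect_eq_sum r β L y x]
  -- per-pair bound
  have hpair : ∀ (p q : {q : Fin 4 × Fin 4 // q.1 < q.2}),
      |torusE G r β L (fun V => plane G r p.1 y V *
          plane G r q.1 (if q.1.1 = 0 then siteReflect x - Pi.single 0 1 else siteReflect x) V) -
        torusE G r β L (plane G r p.1 y) *
          torusE G r β L (plane G r q.1 (if q.1.1 = 0 then siteReflect x - Pi.single 0 1 else siteReflect x))| ≤ M := by
    intro p q
    obtain ⟨h0, hj⟩ := reflSite_coords x (q.1.1 = 0)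
    set x' := (if q.1.1 = 0 then siteReflect x - Pi.single 0 1 else siteReflect x) with hx'
    have hz₁ : ∀ j, |y j| + (R : ℤ) + 6 ≤ (L : ℤ) := fun j => by linarith [hy j]
    have hz₂ : ∀ j, |x' j| + (R : ℤ) + 6 ≤ (L : ℤ) := by
      intro j
      by_cases hj0 : j = 0
      · subst hj0
        have hx0 := hx 0
        have : |x' 0| ≤ |x 0| + 1 := by
          rcases h0 with h | h
          · rw [h, abs_neg]; linarith
          · rw [h]
            have e : (-x 0 - 1 : ℤ) = -(x 0 + 1) := by ring
            rw [e, abs_neg]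
            have := abs_add_le (x 0) 1
            simpa using this
        linarith
      · rw [hj j hj0]; linarith [hx j]
    have hsep' : ∃ j, y j + 2 * (R : ℤ) + 6 ≤ x' j ∨ x' j + 2 * (R : ℤ) + 6 ≤ y j := by
      rcases hsep with h | ⟨j, hj0, h⟩
      · refine ⟨0, Or.inr ?_⟩
        rcases h0 with e | e <;> rw [e] <;> linarith
      · refine ⟨j, ?_⟩
        rw [hj j hj0]
        rcases h with h | h
        · right; linarith
        · left; linarith
    exact abs_torusCov_plane_le_of_expMoments G r hR p.1 q.1 y x' hz₁ hz₂ hsep' hC₁ (hlaw p.1 y p.2) (hlaw q.1 x' q.2)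
  -- sum the 36 (≤ 256) pairs
  have hcard : (Fintype.card {q : Fin 4 × Fin 4 // q.1 < q.2} : ℝ) ≤ 16 := by
    have h := Fintype.card_subtype_le (fun q : Fin 4 × Fin 4 => q.1 < q.2)
    simp only [Fintype.card_prod, Fintype.card_fin] at h
    exact_mod_cast h
  have hcard0 : (0 : ℝ) ≤ Fintype.card {q : Fin 4 × Fin 4 // q.1 < q.2} := Nat.cast_nonneg _
  calc _ ≤ ∑ p : {q : Fin 4 × Fin 4 // q.1 < q.2}, |∑ q : {q : Fin 4 × Fin 4 // q.1 < q.2},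
          (torusE G r β L (fun V => plane G r p.1 y V *
              plane G r q.1 (if q.1.1 = 0 then siteReflect x - Pi.single 0 1 else siteReflect x) V) -
            torusE G r β L (plane G r p.1 y) *
              torusE G r β L (plane G r q.1 (if q.1.1 = 0 then siteReflect x - Pi.single 0 1 else siteReflect x)))| :=
        Finset.abs_sum_le_sum_abs _ _
    _ ≤ ∑ p : {q : Fin 4 × Fin 4 // q.1 < q.2}, ∑ q : {q : Fin 4 × Fin 4 // q.1 < q.2}, M := by
        refine Finset.sum_le_sum fun p _ => ?_
        exact (Finset.abs_sum_le_sum_abs _ _).trans (Finset.sum_le_sum fun q _ => hpair p q)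
    _ = (Fintype.card {q : Fin 4 × Fin 4 // q.1 < q.2} : ℝ) ^ 2 * M := by
        simp only [Finset.sum_const, Finset.card_univ, nsmul_eq_mul]; ring
    _ ≤ 16 ^ 2 * M := by
        apply mul_le_mul_of_nonneg_right _ hM0
        exact pow_le_pow_left₀ hcard0 hcard 2
    _ = 256 * M := by norm_num

end Summit.QuantumFields.YangMills.Cruxes.FiniteRankMirrorPeeling

end
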